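import Literature.Analysis.FluidPDE.FracNSEnergy
import Literature.Analysis.FluidPDE.DeRosaMollificationProofs
import Literature.Analysis.FluidPDE.FractionalNSPrescribedEnergyProlongationProofs
import Literature.Analysis.FunctionSpaces.TorusInverseLaplacianCalculus
import HarnessLib

/-!
# The fractional Laplacian commutes with `Δ`, its iterates and `Δ⁻¹` (De Rosa 2019, §5.2,
# proof of Prop. 5.4)

L. De Rosa, *Infinitely many Leray–Hopf solutions for the fractional Navier–Stokes equations*,
Comm. PDE 44 (2019) 335–365 = arXiv:1801.10235, §5.2, proof of Prop. 5.4 (estimates on the vector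
potentials `zᵢ = ℬvᵢ = (-Δ)⁻¹ curl vᵢ`): the equation for `z̃ᵢ = ℬ(vᵢ - v_ℓ)` is obtained by
applying `ℬ` and `curl` to the equation of `vᵢ - v_ℓ`, which contains the new term
`ν(-Δ)^γ(vᵢ - v_ℓ)`: "`curl(∂ₜz̃ᵢ + (v_ℓ·∇)z̃ᵢ + ν(-Δ)^γ z̃ᵢ) = …`", "`-Δ(∂ₜz̃ᵢ + (v_ℓ·∇)z̃ᵢ +
ν(-Δ)^γ z̃ᵢ) = F`" — i.e. `(-Δ)^γ` is moved through `curl`, `Δ` and `Δ⁻¹` (all Fourier multipliers).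
This file proves those commutations for the tree's operators on smooth fields `T^d → ℝ^d`
(`θ ≥ 0`):

* `Torus.fracLaplacian_laplacian_comm` — `(-Δ)^θ (Δa) = Δ((-Δ)^θ a)` (`Δ = ∑ᵢ∂ᵢ∂ᵢ` and
  `∂ₖ(-Δ)^θ = (-Δ)^θ∂ₖ`, `Torus.partialDeriv_fracLaplacian_comm`), and its iterates;
* `Torus.fracLaplacian_invLaplacian_comm` — `(-Δ)^θ (Δ⁻¹a) = Δ⁻¹((-Δ)^θ a)` (`Δ⁻¹ = c • K ⋆ Δ^{N-1}`,
  `Torus.invLaplacian`; `(-Δ)^θ` commutes with mollification, `Torus.fracLaplacian_convolution_comm`).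

## References

* L. De Rosa, Comm. PDE 44 (2019) 335–365 = arXiv:1801.10235, §5.2, proof of Prop. 5.4
  (pp. 12–13 of the arXiv text). [`Derosa2018`]
-/

noncomputable section

open MeasureTheory Set Function

namespace Literature.Analysis.FluidPDE

namespace Torus

open FunctionSpaces FunctionSpaces.Torus

variable {d : Type} [Fintype d] [DecidableEq d]

/-- **`(-Δ)^θ` commutes with the Laplacian** on smooth fields (`θ ≥ 0`):
`(-Δ)^θ (Δa) = Δ((-Δ)^θ a)`. [cite: Derosa2018, §5.2 proof of Prop. 5.4] -/
theorem fracLaplacian_laplacian_comm {θ : ℝ} (hθ : 0 ≤ θ) {a : UnitAddTorus d → EuclideanSpace ℝ d}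
    (ha : IsSmooth a) :
    fracLaplacian θ (FunctionSpaces.Torus.laplacian a) =
      FunctionSpaces.Torus.laplacian (fracLaplacian θ a) := by
  have hΛ : IsSmooth (fracLaplacian θ a) := ha.fracLaplacian hθ
  have hsum : FunctionSpaces.Torus.laplacian a =
      fun x => ∑ i, FunctionSpaces.Torus.partialDeriv i (FunctionSpaces.Torus.partialDeriv i a) x :=
    funext fun x => laplacian_eq_sum_partialDeriv_partialDeriv ha x
  have hsumΛ : FunctionSpaces.Torus.laplacian (fracLaplacian θ a) =
      fun x => ∑ i, FunctionSpaces.Torus.partialDeriv i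
        (FunctionSpaces.Torus.partialDeriv i (fracLaplacian θ a)) x :=
    funext fun x => laplacian_eq_sum_partialDeriv_partialDeriv hΛ x
  -- `(-Δ)^θ` of a finite sum of smooth fields
  have hfin : ∀ (s : Finset d), fracLaplacian θ (fun x => ∑ i ∈ s,
      FunctionSpaces.Torus.partialDeriv i (FunctionSpaces.Torus.partialDeriv i a) x) =
      fun x => ∑ i ∈ s, fracLaplacian θ
        (FunctionSpaces.Torus.partialDeriv i (FunctionSpaces.Torus.partialDeriv i a)) x := by
    intro s
    induction s using Finset.induction_on with
    | empty =>
      simp only [Finset.sum_empty]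
      exact fracLaplacian_zero_fun θ
    | insert i s hi IH =>
      have hterm : IsSmooth (FunctionSpaces.Torus.partialDeriv i (FunctionSpaces.Torus.partialDeriv i a)) :=
        (ha.partialDeriv i).partialDeriv i
      have hrest : IsSmooth (fun x => ∑ j ∈ s,
          FunctionSpaces.Torus.partialDeriv j (FunctionSpaces.Torus.partialDeriv j a) x) := by
        have h : (fun x => ∑ j ∈ s, FunctionSpaces.Torus.partialDeriv j (FunctionSpaces.Torus.partialDeriv j a) x) =
            ∑ j ∈ s, FunctionSpaces.Torus.partialDeriv j (FunctionSpaces.Torus.partialDeriv j a) := by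
          funext x; simp only [Finset.sum_apply]
        rw [h]
        exact Finset.sum_induction _ IsSmooth (fun f g hf hg => hf.add hg) (isSmooth_const 0)
          fun j _ => (ha.partialDeriv j).partialDeriv j
      simp only [Finset.sum_insert hi]
      rw [fracLaplacian_add hθ hterm hrest, IH]
  have h1 : fracLaplacian θ (FunctionSpaces.Torus.laplacian a) = fun x => ∑ i, fracLaplacian θ
      (FunctionSpaces.Torus.partialDeriv i (FunctionSpaces.Torus.partialDeriv i a)) x := by
    rw [hsum]; exact hfin Finset.univ
  rw [h1, hsumΛ]
  funext x
  refine Finset.sum_congr rfl fun i _ => ?_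
  rw [partialDeriv_fracLaplacian_comm hθ ha i, partialDeriv_fracLaplacian_comm hθ (ha.partialDeriv i) i]

/-- `(-Δ)^θ` commutes with the iterated Laplacian on smooth fields (`θ ≥ 0`). [folklore] -/
theorem fracLaplacian_laplacian_iterate_comm {θ : ℝ} (hθ : 0 ≤ θ) (m : ℕ) :
    ∀ {a : UnitAddTorus d → EuclideanSpace ℝ d}, IsSmooth a →
      fracLaplacian θ (FunctionSpaces.Torus.laplacian^[m] a) =
        FunctionSpaces.Torus.laplacian^[m] (fracLaplacian θ a) := by
  induction m with
  | zero => intro a _; rfl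
  | succ m IH =>
    intro a ha
    rw [Function.iterate_succ_apply, Function.iterate_succ_apply, IH ha.laplacian,
      fracLaplacian_laplacian_comm hθ ha]

/-- **`(-Δ)^θ` commutes with the inverse Laplacian** on smooth fields (`θ ≥ 0`):
`(-Δ)^θ (Δ⁻¹a) = Δ⁻¹((-Δ)^θ a)` (`Δ⁻¹a = c • K ⋆ Δ^{N-1}a` with the integrable continuous kernel
`K = Torus.invLaplacianKernel`; `(-Δ)^θ` commutes with the mollification and with `Δ^{N-1}`). The
identity behind "`ℬ(-Δ)^γ = (-Δ)^γℬ`" in De Rosa's equation for `z̃ᵢ = ℬ(vᵢ - v_ℓ)`.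
[cite: Derosa2018, §5.2 proof of Prop. 5.4] -/
theorem fracLaplacian_invLaplacian_comm {θ : ℝ} (hθ : 0 ≤ θ) {a : UnitAddTorus d → EuclideanSpace ℝ d}
    (ha : IsSmooth a) :
    fracLaplacian θ (FunctionSpaces.Torus.invLaplacian a) =
      FunctionSpaces.Torus.invLaplacian (fracLaplacian θ a) := by
  have hΛ : IsSmooth (fracLaplacian θ a) := ha.fracLaplacian hθ
  have hg : IsSmooth (FunctionSpaces.Torus.laplacian^[Fintype.card d - 1] a) := isSmooth_laplacian_iterate ha _
  unfold FunctionSpaces.Torus.invLaplacian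
  rw [fracLaplacian_const_smul, fracLaplacian_convolution_comm hθ continuous_invLaplacianKernel hg,
    fracLaplacian_laplacian_iterate_comm hθ _ ha]

end Torus

end Literature.Analysis.FluidPDE
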